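import Literature.AlgebraicGeometry.HodgeTheory.AbelianVarietyHodgeFullnessOfUniformisation
import Literature.AlgebraicGeometry.HodgeTheory.ComplexTorusWeightOneComparison
import Literature.AlgebraicGeometry.HodgeTheory.HodgeTypeConjugation
import Literature.AlgebraicGeometry.HodgeTheory.ClassesSupportedOnComplexification
import HarnessLib

/-!
# The `(1,0)`-classes of an algebraic complex torus in canonical lattice coordinates (discharge)

Family `hodge`, layer `Literature/AlgebraicGeometry/HodgeTheory`; theorems only (no definition, no
named fact; D-0026).  This file DISCHARGES the record
`HodgeTheory.complexTorus_latticeCoordHOne_hodgeOneZero` of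
`AbelianVarietyHodgeFullnessOfUniformisation` ([LangeBirkenhake1992] §1.1.5 Thm. 1.1.21 (b) read
through §1.1.3 Lemma 1.1.17 (a): in the coordinates of `H¹(X, ℤ) = Hom(Λ, ℤ)` dual to a lattice
basis, `H^{1,0}(X) = Hom_ℂ(V, ℂ)` is the space of period rows of `ℂ`-linear functionals) — one of
the two analytic records between the displayed binder `hR = DeligneMilne1982_Thm_6_20_full` of the
COR-CM chain and the kernel (`deligneMilne1982_Thm_6_20_full_of_uniformisation`).

The printed proof computes the periods `∫_{λ_b} dxₐ = δ_{ab}` of the invariant one-forms over the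
lattice loops ([LangeBirkenhake1992] §1.1.4, de Rham's theorem (1.5) and Prop. 1.1.20).  The tree's
de Rham comparison is an ABSTRACT natural isomorphism family `e`
(`Transcendental.ComplexDeRhamIsoFamily`, natural among manifolds with the same model space), so the
period computation is replaced by an equivariance argument which the tree can run:

* `exists_ofRatClass_latticeClass_eq_smul_deRham_dx` — **period identification up to one scalar**:
  for every natural complex de Rham family `e` on the model `E` there is `c ≠ 0` in `ℂ` with
  `ξₐ ⊗ 1 = c • e[dxₐ]` in `H¹(E/Φ(ℤ^ι); ℂ)` for ALL `a` (`ξₐ = latticeClass Φ a` the canonical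
  classes, `dxₐ = ComplexTorus.dx Φ a` the invariant coordinate one-forms).  Proof: write
  `ξ_{a₀} ⊗ 1 = e[γ]` with `γ` invariant (`ComplexTorus.cconstClassEquiv`); pull both sides back
  along the rank-one integer endomorphism `B = E_{a₀c}` of the torus (`mapMatrix Φ Φ B`, real
  `C^∞`): on the singular side `B^* ξ_{a₀} = ξ_c` (`map_latticeClass_of_mapMatrix`,
  `Motives.ofRatClass_map`), on the de Rham side `B^* e[γ] = e[γ ∘ ρ(B)] = γ(Φe_{a₀}) • e[dx_c]`
  (naturality of `e`, `Barriers.HodgeConjecture.cmap_cconstClass_mapMatrix_self`,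
  `ComplexTorus.comp_realRep_elementary₁`), whence `ξ_c ⊗ 1 = γ(Φe_{a₀}) • e[dx_c]` for every `c`
  with the SAME scalar.
* `ofRatClassBaseChange_mem_map_hodgePQ_iff` — for `y ∈ ℂ ⊗_ℚ H¹(T; ℚ)`: `β(y) ∈ e(H^{1,0}(T))` iff
  `(latticeCoordHOne Φ ⊗ ℂ) y ∈ hodgeOneZeroRows Φ` (expand `y` in the basis `ξₐ`;
  `H^{1,0}(T) = {[ω_ℓ] : ℓ ∈ Hom_ℂ(E, ℂ)}`, `ComplexTorus.mem_hodgePQ_one_zero_iff`; an invariant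
  one-form is `Σₐ ω(Φeₐ) dxₐ`, `ComplexTorus.eq_sum_apply_smul_dx`).
* `complexTorus_latticeCoordHOne_hodgeOneZero_holds` — the record, by reading the Hodge type of a
  class on `X(ℂ)` in the torus Hodge model attached to the analytification `φ`
  (`isOfHodgeType_iff_mem_hodgePQ`) and the naturality `φ^* ∘ β_X = β_T ∘ (φ^* ⊗ ℂ)`
  (`map_ofRatClassBaseChange`).

## References

* [LangeBirkenhake1992] H. Lange, Ch. Birkenhake, *Complex Abelian Varieties* (1992), §1.1.3
  (1.3)–(1.4), Lemma 1.1.17 (a); §1.1.4 (1.5), Prop. 1.1.20; §1.1.5 Thm. 1.1.21, Prop. 1.1.23 (held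
  text `book:lange1992-complex-abelian-varieties`, chunks p0023–p0026).
* [VoisinHodgeI2002] C. Voisin, *Hodge Theory and Complex Algebraic Geometry I*, §7.2.2.
* [HatcherAT2002] A. Hatcher, *Algebraic Topology*, §3.1 p. 198, §3.2 Example 3.16.
-/

noncomputable section

open scoped TensorProduct Manifold ContDiff
open CategoryTheory
open Literature.AlgebraicTopology.SingularHomology Literature.NumberTheory.Transcendental
  Literature.Geometry.Kaehler
open Literature.AlgebraicGeometry.Motives (ofRatClassBaseChange ofRatClassBaseChange_tmul
  ComplexPoints IsSmoothProjective SchemeOver)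

namespace Literature.AlgebraicGeometry.HodgeTheory

section Torus

variable {ι : Type} [Fintype ι] [DecidableEq ι] {E : Type} [NormedAddCommGroup E] [NormedSpace ℂ E]
  [FiniteDimensional ℂ E] (Φ : (ι → ℝ) ≃L[ℝ] E)

omit [FiniteDimensional ℂ E] in
/-- The rank-one integer matrix `E_{a c}` (entry `1` at `(a, c)`, `0` elsewhere): the endomorphism
`mapMatrix Φ Φ E_{ac}` of the torus satisfies `E_{ac}^* ξ_{a'} = δ_{a'a} ξ_c` (file-local plumbing
for the equivariance argument). [folklore] -/
private theorem map_mapMatrix_elementary_latticeClass (a c a' : ι)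
    (h : C(ComplexTorus Φ, ComplexTorus Φ))
    (hh : ∀ t, h t = ComplexTorus.mapMatrix Φ Φ
      (Matrix.of fun i j => if j = c then (if i = a then (1 : ℤ) else 0) else 0) t) :
    singularCohomology.map ℚ ℚ h 1 (latticeClass Φ a') =
      if a' = a then latticeClass Φ c else 0 := by
  rw [map_latticeClass_of_mapMatrix Φ Φ _ h hh a']
  by_cases ha : a' = a
  · subst ha
    rw [if_pos rfl, Finset.sum_eq_single c (fun j _ hj => by simp [Matrix.of_apply, hj])
      (fun hc => absurd (Finset.mem_univ c) hc)]
    simp [Matrix.of_apply]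
  · rw [if_neg ha]
    exact Finset.sum_eq_zero fun j _ => by simp [Matrix.of_apply, ha]

/-- **Period identification up to one scalar** ([LangeBirkenhake1992] §1.1.4: under de Rham's
isomorphism (1.5) the invariant form `dxₐ` is the class dual to the lattice vector `λₐ`, i.e.
`∫_{λ_b} dxₐ = δ_{ab}`, Prop. 1.1.20).  For the tree's ABSTRACT natural de Rham family `e` on the
model `E` the statement holds up to one non-zero scalar: there is `c ≠ 0` with
`ξₐ ⊗ 1 = c • e[dxₐ]` in `H¹(E/Φ(ℤ^ι); ℂ)` for all `a`, where `ξₐ = latticeClass Φ a`.  Proof by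
equivariance under the rank-one integer endomorphisms `E_{a₀c}` of the torus (module docstring).
[cite: LangeBirkenhake1992, §1.1.4 (1.5) and Prop. 1.1.20; §1.1.3 Lemma 1.1.17 (a)] -/
theorem exists_ofRatClass_latticeClass_eq_smul_deRham_dx {e : ComplexDeRhamIsoFamily E}
    (he : e.IsNatural) :
    ∃ c : ℂ, c ≠ 0 ∧ ∀ a : ι, ofRatClass (ComplexTorus Φ) 1 (latticeClass Φ a) =
      c • e (ComplexTorus Φ) 1 (ComplexTorus.cconstClass Φ (ComplexTorus.dx Φ a)) := by
  cases isEmpty_or_nonempty ι with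
  | inl hι => exact ⟨1, one_ne_zero, fun a => (IsEmpty.false a).elim⟩
  | inr hι =>
    obtain ⟨a₀⟩ := hι
    -- the invariant representative `γ` of `ξ_{a₀} ⊗ 1`
    set γ : E [⋀^Fin 1]→L[ℝ] ℂ := (ComplexTorus.cconstClassEquiv Φ (k := 1)).symm
      ((e (ComplexTorus Φ) 1).symm (ofRatClass (ComplexTorus Φ) 1 (latticeClass Φ a₀))) with hγ
    have heγ : e (ComplexTorus Φ) 1 (ComplexTorus.cconstClass Φ γ) =
        ofRatClass (ComplexTorus Φ) 1 (latticeClass Φ a₀) := by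
      rw [hγ, ← ComplexTorus.cconstClassEquiv_apply, LinearEquiv.apply_symm_apply,
        LinearEquiv.apply_symm_apply]
    -- the key identity, one rank-one endomorphism per coordinate `c`
    have key : ∀ c : ι, ofRatClass (ComplexTorus Φ) 1 (latticeClass Φ c) =
        γ ![Φ (Pi.single a₀ (1 : ℝ))] •
          e (ComplexTorus Φ) 1 (ComplexTorus.cconstClass Φ (ComplexTorus.dx Φ c)) := by
      intro c
      set B : Matrix ι ι ℤ :=
        Matrix.of fun i j => if j = c then (if i = a₀ then (1 : ℤ) else 0) else 0 with hB
      have hF := ComplexTorus.contMDiff_real_mapMatrix (Φ := Φ) (Φ' := Φ) (n := ∞) B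
      -- singular side: `B^* (ξ_{a₀} ⊗ 1) = ξ_c ⊗ 1`
      have h1 : singularCohomology.map ℂ ℂ ⟨ComplexTorus.mapMatrix Φ Φ B, hF.continuous⟩ 1
          (ofRatClass (ComplexTorus Φ) 1 (latticeClass Φ a₀)) =
            ofRatClass (ComplexTorus Φ) 1 (latticeClass Φ c) := by
        rw [← Motives.ofRatClass_map, map_mapMatrix_elementary_latticeClass Φ a₀ c a₀ _
          (fun _ => rfl), if_pos rfl]
      -- de Rham side: `B^* e[γ] = e[γ ∘ ρ(B)] = γ(Φ e_{a₀}) • e[dx_c]`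
      have h2 : singularCohomology.map ℂ ℂ ⟨ComplexTorus.mapMatrix Φ Φ B, hF.continuous⟩ 1
          (e (ComplexTorus Φ) 1 (ComplexTorus.cconstClass Φ γ)) =
            γ ![Φ (Pi.single a₀ (1 : ℝ))] •
              e (ComplexTorus Φ) 1 (ComplexTorus.cconstClass Φ (ComplexTorus.dx Φ c)) := by
        rw [← he _ _ _ hF 1,
          Literature.Barriers.HodgeConjecture.cmap_cconstClass_mapMatrix_self Φ B γ, hB,
          ComplexTorus.comp_realRep_elementary₁ Φ γ a₀ c, map_smul, map_smul]
      rw [← h1, ← heγ, h2]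
    refine ⟨γ ![Φ (Pi.single a₀ (1 : ℝ))], ?_, key⟩
    -- the scalar is non-zero: otherwise `ξ_{a₀} ⊗ 1 = 0`, but `ξ_{a₀} ≠ 0`
    intro h0
    have h := key a₀
    rw [h0, zero_smul] at h
    exact (linearIndependent_latticeClass Φ).ne_zero a₀
      (ofRatClass_injective 1 (by rw [h, map_zero]))

/-- **`H^{1,0}` in canonical lattice coordinates** ([LangeBirkenhake1992] Thm. 1.1.21 (b) with
Lemma 1.1.17 (a), Cor. 1.1.19: `H^{1,0}(X) = Ω = Hom_ℂ(V, ℂ) ⊂ Hom_ℝ(V, ℂ) = Hom(Λ, ℤ) ⊗ ℂ`): for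
`y ∈ ℂ ⊗_ℚ H¹(E/Φ(ℤ^ι); ℚ)` and a natural de Rham family `e`, the class `β(y) = y ⊗ 1` lies in
`e(H^{1,0})` iff the canonical coordinates `(latticeCoordHOne Φ ⊗ ℂ) y` form the period row of a
`ℂ`-linear functional (`hodgeOneZeroRows Φ`).
[cite: LangeBirkenhake1992, §1.1.5 Thm. 1.1.21 (b) and §1.1.3 Lemma 1.1.17 (a), Cor. 1.1.19] -/
theorem ofRatClassBaseChange_mem_map_hodgePQ_iff {e : ComplexDeRhamIsoFamily E} (he : e.IsNatural)
    (y : ℂ ⊗[ℚ] singularCohomology ℚ ℚ (ComplexTorus Φ) 1) :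
    ofRatClassBaseChange (ComplexTorus Φ) 1 y ∈
        (hodgePQ E (ComplexTorus Φ) 1 1 0).map (e (ComplexTorus Φ) 1).toLinearMap ↔
      (latticeCoordHOne Φ).toLinearMap.baseChange ℂ y ∈ hodgeOneZeroRows Φ := by
  obtain ⟨c, hc0, hc⟩ := exists_ofRatClass_latticeClass_eq_smul_deRham_dx Φ he
  -- coordinates `ζ` of `y`: `(coord ⊗ ℂ) y = Σ ζₐ ⊗ eₐ`, `y = Σ ζₐ ⊗ ξₐ`
  obtain ⟨ζ, hζ⟩ := exists_eq_sum_tmul_single ((latticeCoordHOne Φ).toLinearMap.baseChange ℂ y)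
  have hy : y = ∑ a, ζ a ⊗ₜ[ℚ] latticeClass Φ a := by
    have h1 : y = (latticeCoordHOne Φ).symm.toLinearMap.baseChange ℂ
        ((latticeCoordHOne Φ).toLinearMap.baseChange ℂ y) := by
      rw [← LinearMap.comp_apply, ← LinearMap.baseChange_comp]
      have h2 : (latticeCoordHOne Φ).symm.toLinearMap ∘ₗ (latticeCoordHOne Φ).toLinearMap =
          LinearMap.id := LinearMap.ext fun v => (latticeCoordHOne Φ).symm_apply_apply v
      rw [h2, LinearMap.baseChange_id, LinearMap.id_apply]
    rw [h1, hζ, map_sum]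
    refine Finset.sum_congr rfl fun a _ => ?_
    rw [LinearMap.baseChange_tmul, LinearEquiv.coe_coe, ← latticeCoordHOne_latticeClass Φ a,
      LinearEquiv.symm_apply_apply]
  -- the invariant one-form `wf = Σ ζₐ dxₐ` and its functional `m`
  set wf : E [⋀^Fin 1]→L[ℝ] ℂ := ∑ a, ζ a • ComplexTorus.dx Φ a with hwf
  set m : E →L[ℝ] ℂ := oneForm.symm wf with hm
  have hwfm : oneForm m = wf := oneForm.apply_symm_apply wf
  have hma : ∀ a, m (Φ (Pi.single a (1 : ℝ))) = ζ a := by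
    intro a
    have h1 : m (Φ (Pi.single a (1 : ℝ))) = wf ![Φ (Pi.single a (1 : ℝ))] := by
      rw [← hwfm, oneForm_apply, Matrix.cons_val_zero]
    rw [h1, hwf, ContinuousAlternatingMap.sum_apply]
    simp only [ContinuousAlternatingMap.smul_apply, ComplexTorus.dx_apply_single, smul_eq_mul,
      mul_ite, mul_one, mul_zero, Finset.sum_ite_eq', Finset.mem_univ, if_true]
  have hz : (latticeCoordHOne Φ).toLinearMap.baseChange ℂ y = periodRow Φ (m : E →ₗ[ℝ] ℂ) := by
    rw [hζ, periodRow_apply]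
    simp only [ContinuousLinearMap.coe_coe, hma]
  -- `β(y) = c • e[wf]`
  have hβ : ofRatClassBaseChange (ComplexTorus Φ) 1 y =
      c • e (ComplexTorus Φ) 1 (ComplexTorus.cconstClass Φ wf) := by
    rw [hy, map_sum, hwf, map_sum, map_sum, Finset.smul_sum]
    refine Finset.sum_congr rfl fun a _ => ?_
    rw [ofRatClassBaseChange_tmul, hc a, map_smul, map_smul, smul_comm]
  rw [hβ, Submodule.smul_mem_iff _ hc0, Submodule.mem_map_equiv, LinearEquiv.symm_apply_apply,
    ComplexTorus.mem_hodgePQ_one_zero_iff, hz, mem_hodgeOneZeroRows_iff]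
  constructor
  · rintro ⟨ℓ, hℓ⟩
    refine ⟨ℓ, ?_⟩
    have h1 : oneForm (ℓ.restrictScalars ℝ) = wf :=
      (ComplexTorus.cconstClassEquiv Φ (k := 1)).injective
        (by rw [ComplexTorus.cconstClassEquiv_apply, ComplexTorus.cconstClassEquiv_apply, hℓ])
    have h2 : (ℓ.restrictScalars ℝ : E →L[ℝ] ℂ) = m := oneForm.injective (h1.trans hwfm.symm)
    rw [← h2, ContinuousLinearMap.coe_restrictScalars]
  · rintro ⟨ℓ, hℓ⟩
    refine ⟨ℓ, ?_⟩
    have h2 : ℓ.toLinearMap.restrictScalars ℝ = (m : E →ₗ[ℝ] ℂ) := periodRow_injective Φ hℓ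
    have h3 : (ℓ.restrictScalars ℝ : E →L[ℝ] ℂ) = m :=
      ContinuousLinearMap.coe_injective (by rw [ContinuousLinearMap.coe_restrictScalars, h2])
    rw [h3, hwfm]

end Torus

/-- **Discharge of `complexTorus_latticeCoordHOne_hodgeOneZero`** ([LangeBirkenhake1992] Thm. 1.1.21
for an ALGEBRAIC torus, read through its analytification): for a smooth projective `X/ℂ` of
dimension `n` analytified by the complex torus `E/Φ(ℤ^ι)` via `φ`, a class `x ∈ ℂ ⊗_ℚ H¹(X(ℂ); ℚ)`
is of Hodge type `(1,0)` iff its canonical lattice coordinates lie in `hodgeOneZeroRows Φ`.  The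
Hodge type is read in the torus Hodge model `(E, E/Φ(ℤ^ι), φ, e)` (`isOfHodgeType_iff_mem_hodgePQ`,
model independence), the pull-back commutes with complexification (`map_ofRatClassBaseChange`), and
on the torus the statement is `ofRatClassBaseChange_mem_map_hodgePQ_iff`.
[cite: LangeBirkenhake1992, §1.1.5 Thm. 1.1.21 (b), §1.1.3 Lemma 1.1.17 (a)]
[cite: SerreGAGA1956, §2] -/
theorem complexTorus_latticeCoordHOne_hodgeOneZero_holds :
    complexTorus_latticeCoordHOne_hodgeOneZero := by
  intro ι _ _ E _ _ _ Φ n X hX φ hφ x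
  obtain ⟨e, he, -⟩ := exists_isReal_complexDeRhamIsoFamily_holds E
  let B : HodgeModel n X :=
    { model := E, carrier := ComplexTorus Φ, toComplexPoints := φ, isAnalytification := hφ,
      deRham := e, deRham_isNatural := he, isInternal_hodgePQ := ComplexTorus.isInternal_hodgePQ Φ }
  rw [isOfHodgeType_iff_mem_hodgePQ hX B]
  have hφc : (⟨φ, hφ.isHomeomorph.continuous⟩ : C(ComplexTorus Φ, ComplexPoints X)) = φ :=
    ContinuousMap.ext fun _ => rfl
  have hpull : B.pullback 1 (ofRatClassBaseChange (ComplexPoints X) 1 x) =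
      ofRatClassBaseChange (ComplexTorus Φ) 1
        ((singularCohomology.map ℚ ℚ φ 1).hom.baseChange ℂ x) := by
    change singularCohomology.map ℂ ℂ ⟨φ, hφ.isHomeomorph.continuous⟩ 1 _ = _
    rw [hφc, map_ofRatClassBaseChange]
  rw [hpull, show B.hodgePQ 1 1 0 =
      (hodgePQ E (ComplexTorus Φ) 1 1 0).map (e (ComplexTorus Φ) 1).toLinearMap from rfl,
    ofRatClassBaseChange_mem_map_hodgePQ_iff Φ he, LinearMap.baseChange_comp, LinearMap.comp_apply]

end Literature.AlgebraicGeometry.HodgeTheory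

end
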